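import Literature.NumberTheory.EllipticCurves.BSDRankZeroDensityProofs
import HarnessLib

/-!
# `Ш(E/K)[n] = 0` from an exact `n`-descent count (proofs)

A full `n`-descent that returns `#Sel^(n)(E/K) = n^{rank E(K)} · #E(K)[n]` — the size of the image
of `E(K)/nE(K)` under the Kummer map — certifies that `Ш(E/K)` has no element of order dividing
`n`: by the exact descent count `#Sel^(n)(E/K) = n^{rank E(K)} · #E(K)[n] · #Ш(E/K)[n]`
(Silverman, *AEC*, Thm X.4.2, proved in the tree as `WeierstrassCurve.natCard_selmerGroup_eq`) the
last factor is `1`. This is the kernel-side reading of a `3`-descent certificate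
«`dim_{𝔽₃} Sel^(3)(E/ℚ) = r + dim_{𝔽₃} E(ℚ)[3]`» as the binder `∀ x : Ш(E/ℚ), 3 • x = 0 → x = 0` of
the per-curve `BSD(E, p)` records (`Rank1Residual.Typed.bsdp_of_shaAn_unit_of_noPTorsion`).
Everything here is proved; no named fact is introduced.

## Contents

* `WeierstrassCurve.sha_inf_torsionBy_eq_bot_of_natCard_selmerGroup_eq` — `Ш ⊓ H¹(K,E)[n] = ⊥`.
* `WeierstrassCurve.sha_torsion_eq_zero_of_natCard_selmerGroup_eq` — `∀ x : Ш, n • x = 0 → x = 0`.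
* `WeierstrassCurve.natCard_selmerGroup_eq_iff_sha_torsion_eq_zero` — the count is exact iff
  `Ш[n] = 0`.

## References

* [SilvermanAEC2009] J. H. Silverman, *The Arithmetic of Elliptic Curves*, 2nd ed., Thm X.4.2.
* [SchaeferStoll2004] E. F. Schaefer, M. Stoll, *How to do a p-descent on an elliptic curve*,
  Trans. AMS 356 (2004), §1 (the descent computes `Sel^(p)`; `Ш[p] = 0` iff the bound is attained).
-/

noncomputable section

open scoped Classical
open scoped AddSubgroup

universe u

namespace WeierstrassCurve

variable {K : Type u} [Field K] [NumberField K] (W : WeierstrassCurve K) [W.IsElliptic]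

/-- **An exact `n`-descent count kills `Ш[n]`**: if `#Sel^(n)(E/K) = n^{rank E(K)} · #E(K)[n]`
(`n ≥ 1`), then `Ш(E/K) ⊓ H¹(K, E)[n] = ⊥`. Proof: compare with the exact descent count
`#Sel^(n) = n^{rank} · #E(K)[n] · #Ш[n]` (`natCard_selmerGroup_eq`); the Selmer group is finite and
non-empty, so the common factor is positive and `#Ш[n] = 1`.
[cite: SilvermanAEC2009, Thm X.4.2] -/
theorem sha_inf_torsionBy_eq_bot_of_natCard_selmerGroup_eq {n : ℕ} (hn : n ≠ 0)
    (hSel : Nat.card (W.selmerGroup n) =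
      n ^ W.mordellWeilRank * Nat.card (W.toAffine.Point[(n : ℤ)])) :
    (W.sha ⊓ AddSubgroup.torsionBy W.galH1 (n : ℤ) : AddSubgroup W.galH1) = ⊥ := by
  have hn' : (n : ℤ) ≠ 0 := Int.natCast_ne_zero.mpr hn
  haveI : Finite (W.selmerGroup n) := W.finite_selmerGroup_holds hn'
  have hpos : 0 < Nat.card (W.selmerGroup n) := Nat.card_pos
  have hcard := W.natCard_selmerGroup_eq hn
  rw [hSel] at hcard hpos
  refine AddSubgroup.eq_bot_of_card_eq _ (Nat.eq_of_mul_eq_mul_left hpos ?_)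
  rw [mul_one]
  exact hcard.symm

/-- **`Ш(E/K)` has no non-zero element killed by `n`** when the `n`-descent count is exact,
`#Sel^(n)(E/K) = n^{rank E(K)} · #E(K)[n]` — the shape `∀ x : Ш(E/K), n • x = 0 → x = 0` of the
certificate binder of the per-curve `BSD(E, p)` records. [cite: SilvermanAEC2009, Thm X.4.2] -/
theorem sha_torsion_eq_zero_of_natCard_selmerGroup_eq {n : ℕ} (hn : n ≠ 0)
    (hSel : Nat.card (W.selmerGroup n) =
      n ^ W.mordellWeilRank * Nat.card (W.toAffine.Point[(n : ℤ)])) :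
    ∀ x : W.sha, (n : ℤ) • x = 0 → x = 0 := by
  intro x hx
  have hbot := W.sha_inf_torsionBy_eq_bot_of_natCard_selmerGroup_eq hn hSel
  have hmem : (x : W.galH1) ∈
      (W.sha ⊓ AddSubgroup.torsionBy W.galH1 (n : ℤ) : AddSubgroup W.galH1) := by
    refine AddSubgroup.mem_inf.mpr ⟨x.2, AddSubgroup.torsionBy.nsmul_iff.mpr ?_⟩
    rw [← natCast_zsmul, ← AddSubgroupClass.coe_zsmul, hx, ZeroMemClass.coe_zero]
  rw [hbot, AddSubgroup.mem_bot] at hmem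
  exact Subtype.ext hmem

/-- **The `n`-descent count is exact iff `Ш(E/K)[n] = 0`** (`n ≥ 1`): the converse direction of
`sha_torsion_eq_zero_of_natCard_selmerGroup_eq`, again from `natCard_selmerGroup_eq`.
[cite: SilvermanAEC2009, Thm X.4.2] -/
theorem natCard_selmerGroup_eq_iff_sha_torsion_eq_zero {n : ℕ} (hn : n ≠ 0) :
    Nat.card (W.selmerGroup n) = n ^ W.mordellWeilRank * Nat.card (W.toAffine.Point[(n : ℤ)]) ↔
      ∀ x : W.sha, (n : ℤ) • x = 0 → x = 0 := by
  refine ⟨W.sha_torsion_eq_zero_of_natCard_selmerGroup_eq hn, fun h => ?_⟩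
  have hbot : (W.sha ⊓ AddSubgroup.torsionBy W.galH1 (n : ℤ) : AddSubgroup W.galH1) = ⊥ := by
    rw [eq_bot_iff]
    intro y hy
    obtain ⟨hyS, hyT⟩ := AddSubgroup.mem_inf.mp hy
    have h0 : (⟨y, hyS⟩ : W.sha) = 0 := by
      refine h ⟨y, hyS⟩ (Subtype.ext ?_)
      rw [AddSubgroupClass.coe_zsmul, ZeroMemClass.coe_zero, natCast_zsmul]
      exact AddSubgroup.torsionBy.nsmul_iff.mp hyT
    rw [AddSubgroup.mem_bot]
    exact congrArg Subtype.val h0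
  have hcard := W.natCard_selmerGroup_eq hn
  rw [hbot, AddSubgroup.card_bot, mul_one] at hcard
  exact hcard

/-! ### The same readings under an arbitrary `DecidableEq K` instance

The group law on `E(K)` (Mathlib) is stated under a `DecidableEq K` instance; above it is the
classical one (`open scoped Classical`, the tree's convention). A certificate binder typed over `ℚ`
WITHOUT `open scoped Classical` elaborates `#E(ℚ)[n]` with `instDecidableEqRat` instead, and then
`exact` does not apply the lemmas above verbatim (reader 1's finding on p543805). The primed versions
below take `hSel` under ANY instance `[DecidableEq K]`; the counts agree because `DecidableEq K` is a
subsingleton. -/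

section AnyDecidableEq

variable {K : Type u} [Field K] [NumberField K] [DecidableEq K] (W : WeierstrassCurve K)
  [W.IsElliptic]

/-- `sha_torsion_eq_zero_of_natCard_selmerGroup_eq` with the `n`-torsion count of `hSel` read under
the ambient `DecidableEq K` instance (e.g. `instDecidableEqRat`): an exact `n`-descent count
`#Sel^(n)(E/K) = n^{rank E(K)} · #E(K)[n]` gives `∀ x : Ш(E/K), n • x = 0 → x = 0`.
[cite: SilvermanAEC2009, Thm X.4.2] -/
theorem sha_torsion_eq_zero_of_natCard_selmerGroup_eq' {n : ℕ} (hn : n ≠ 0)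
    (hSel : Nat.card (W.selmerGroup n) =
      n ^ W.mordellWeilRank * Nat.card (W.toAffine.Point[(n : ℤ)])) :
    ∀ x : W.sha, (n : ℤ) • x = 0 → x = 0 := by
  refine W.sha_torsion_eq_zero_of_natCard_selmerGroup_eq hn ?_
  convert hSel

/-- `natCard_selmerGroup_eq_iff_sha_torsion_eq_zero` under the ambient `DecidableEq K` instance.
[cite: SilvermanAEC2009, Thm X.4.2] -/
theorem natCard_selmerGroup_eq_iff_sha_torsion_eq_zero' {n : ℕ} (hn : n ≠ 0) :
    Nat.card (W.selmerGroup n) = n ^ W.mordellWeilRank * Nat.card (W.toAffine.Point[(n : ℤ)]) ↔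
      ∀ x : W.sha, (n : ℤ) • x = 0 → x = 0 := by
  have h := W.natCard_selmerGroup_eq_iff_sha_torsion_eq_zero hn
  convert h

end AnyDecidableEq

end WeierstrassCurve
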